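import Mathlib
import Summits.Ventures.PercRepro2.SwAllHMarkDefs

/-!
# THE MARK WITH NEIGHBOURS `p` AND `l`, I: the transports (blind cell PercRepro2, night-4 g30,
2026-08-28; proofs/NIGHT4-G30.md §8)

Let `x` be an L-MARK vertex relative to `p`: ONE edge `e₀ = x–p` and at least one edge `x–l`, no
other edge (`IsLMarkAt`).  On the side `Q_x = {h ∉ H_l, x ∈ C_R(l) ∖ C_B(l)}` every edge `x–l` is
red (a blue one puts `x` into `C_B(l)`), and the clusters of `l` in the graph are read in the
isolated graph `isolate ends x` through two transports: in the RED colouring `x` is attached to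
`l` and carries the red cluster of `p` when `e₀` is red
(`IsLMarkAt.cluster_eq_of_allRed`: `C_R(l) = C′_R(l) ∪ {x} ∪ (C′_R(p) if e₀ red)`); in the BLUE
colouring `x` is a leaf at `p` (`IsLMarkAt.cluster_blue_transport`).  Hence
`IsLMarkAt.mem_tgt_iff`: `Q_x = {every x–l red, h ∉ H′_l, (e₀ red → p ∉ C′_R(h)), (e₀ blue →
p ∉ C′_B(l))}` — with `e₀` red the NEGATIVE-MARK side `N′(p)`, with `e₀` blue the side of `p` with
its symmetric part; and on `Q_x` the red edge set of `h` is that of the isolated graph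
(`IsLMarkAt.redEdges_eq`).  The theorem (`IsLMarkAt.swAll_lMark`, next file): row 2′SW-ALL with
the mark at `x` follows from the NEGATIVE-MARK domination and the row with the mark at `p` on
the isolated graph.
-/

namespace Summit.Ventures.PercRepro2

namespace LocRows

open Hull

variable {V : Type*} {E : Type*}

open scoped Classical

/-- `x` is an L-MARK vertex relative to `p`: one edge `e₀ = x–p`, at least one edge `x–l`, every
edge at `x` is `e₀` or joins `x` to `l`. -/
structure IsLMarkAt (ends : E → Sym2 V) (x p l : V) (e₀ : E) : Prop where
  xp : x ≠ p
  xl : x ≠ l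
  pl : p ≠ l
  ends₀ : ends e₀ = s(x, p)
  some_l : ∃ d, ends d = s(x, l)
  edges : ∀ e, x ∈ ends e → e = e₀ ∨ ends e = s(x, l)

variable {ends : E → Sym2 V} {x p l : V} {e₀ : E} (hm : IsLMarkAt ends x p l e₀)
include hm

/-- An edge at `x` other than `e₀` joins `x` to `l`. -/
lemma IsLMarkAt.ends_eq_of_ne {e : E} (hxe : x ∈ ends e) (hee : e ≠ e₀) : ends e = s(x, l) := by
  rcases hm.edges e hxe with h | h
  · exact absurd h hee
  · exact h

/-- `e₀` is not an edge `x–l`. -/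
lemma IsLMarkAt.ends₀_ne : ends e₀ ≠ s(x, l) := by
  rw [hm.ends₀]
  intro h
  rw [Sym2.eq_iff] at h
  rcases h with ⟨-, h⟩ | ⟨h, -⟩
  · exact hm.pl h
  · exact hm.xl h

/-- The other end of an edge at `x` is `p` (for `e₀`) or `l`. -/
lemma IsLMarkAt.other_eq {e : E} {y : V} (h : ends e = s(x, y)) : (e = e₀ ∧ y = p) ∨ y = l := by
  have hxe : x ∈ ends e := by rw [h]; exact Sym2.mem_mk_left _ _
  rcases hm.edges e hxe with rfl | h'
  · rw [hm.ends₀, Sym2.eq_iff] at h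
    rcases h with ⟨-, h⟩ | ⟨-, h2⟩
    · exact Or.inl ⟨rfl, h.symm⟩
    · exact absurd h2.symm hm.xp
  · rw [h', Sym2.eq_iff] at h
    rcases h with ⟨-, h⟩ | ⟨-, h2⟩
    · exact Or.inr h.symm
    · exact absurd h2.symm hm.xl

/-- **The red cluster of `l` when every edge `x–l` is red**: the cluster of the isolated graph,
`x`, and the red cluster of `p` of the isolated graph when `e₀` is red. -/
theorem IsLMarkAt.cluster_eq_of_allRed {ζ : Config E}
    (hd : ∀ d, ends d = s(x, l) → ζ d = true) :
    cluster ends ζ l =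
      cluster (isolate ends x) ζ l ∪ {x} ∪
        {y | ζ e₀ = true ∧ y ∈ cluster (isolate ends x) ζ p} := by
  obtain ⟨d₀, hd₀⟩ := hm.some_l
  have hxR : x ∈ cluster ends ζ l :=
    mem_cluster_of_edge (mem_cluster_self _ _ _) (hd d₀ hd₀) (ends_swap hd₀)
  apply Set.Subset.antisymm
  · intro w hw
    refine mem_of_conn_of_closed (ends := ends) (ω := ζ) ?_
      (Or.inl (Or.inl (mem_cluster_self _ _ _))) hw
    rintro a ha b hab
    obtain ⟨hne, e, he, hends⟩ := openGraph_adj.1 hab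
    by_cases hbx : b = x
    · exact Or.inl (Or.inr hbx)
    by_cases hax : a = x
    · -- leaving `x`: to `l` or, through a red `e₀`, to `p`
      rw [hax] at hends
      rcases hm.other_eq hends with ⟨rfl, rfl⟩ | rfl
      · exact Or.inr ⟨he, mem_cluster_self _ _ _⟩
      · exact Or.inl (Or.inl (mem_cluster_self _ _ _))
    · have hends' := isolate_eq_of_ends_eq hax hbx hends
      rcases ha with (ha | ha) | ⟨he₀, ha⟩
      · exact Or.inl (Or.inl (mem_cluster_of_edge ha he hends'))
      · exact absurd ha hax
      · exact Or.inr ⟨he₀, mem_cluster_of_edge ha he hends'⟩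
  · rintro w ((hw | hw) | ⟨he₀, hw⟩)
    · exact cluster_isolate_subset ζ l hw
    · rw [Set.mem_singleton_iff] at hw
      rw [hw]; exact hxR
    · have hp : p ∈ cluster ends ζ l := mem_cluster_of_edge hxR he₀ hm.ends₀
      exact conn_trans hp (cluster_isolate_subset ζ p hw)

/-- **In a colouring with every edge `x–l` closed, `x` is a leaf at `p`**: for a root `v ≠ x`,
away from `x` the clusters of the graph and of the isolated graph agree, and `x` is in the
cluster iff `e₀` is open and `p` is in the cluster of the isolated graph. -/
theorem IsLMarkAt.cluster_transport_leaf {ω : Config E} (hd : ∀ d, ends d = s(x, l) → ω d = false)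
    {v : V} (hv : v ≠ x) :
    (∀ w, w ≠ x → (w ∈ cluster ends ω v ↔ w ∈ cluster (isolate ends x) ω v)) ∧
    (x ∈ cluster ends ω v ↔ ω e₀ = true ∧ p ∈ cluster (isolate ends x) ω v) := by
  have hS : cluster ends ω v ⊆ {y | (y ≠ x ∧ y ∈ cluster (isolate ends x) ω v) ∨
      (y = x ∧ ω e₀ = true ∧ p ∈ cluster (isolate ends x) ω v)} := by
    intro y hy
    refine mem_of_conn_of_closed (ends := ends) (ω := ω) ?_
      (Or.inl ⟨hv, mem_cluster_self _ _ _⟩) hy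
    rintro a ha b hab
    obtain ⟨hne, e, he, hends⟩ := openGraph_adj.1 hab
    by_cases hbx : b = x
    · rw [hbx] at hends hne
      have ha' : a ∈ cluster (isolate ends x) ω v := by
        rcases ha with ⟨-, ha⟩ | ⟨hax, -⟩
        · exact ha
        · exact absurd hax hne
      rcases hm.other_eq (ends_swap hends) with ⟨rfl, rfl⟩ | rfl
      · exact Or.inr ⟨hbx, he, ha'⟩
      · exfalso
        rw [hd e (ends_swap hends)] at he
        exact Bool.noConfusion he
    · refine Or.inl ⟨hbx, ?_⟩
      rcases ha with ⟨hax, ha'⟩ | ⟨hax, he₀, hp⟩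
      · exact mem_cluster_of_edge ha' he (isolate_eq_of_ends_eq hax hbx hends)
      · rw [hax] at hends
        rcases hm.other_eq hends with ⟨-, rfl⟩ | rfl
        · exact hp
        · exfalso
          rw [hd e hends] at he
          exact Bool.noConfusion he
  constructor
  · intro w hw
    constructor
    · intro hw'
      rcases hS hw' with ⟨-, h'⟩ | ⟨h', -⟩
      · exact h'
      · exact absurd h' hw
    · exact fun hw' => cluster_isolate_subset ω v hw'
  · constructor
    · intro hx
      rcases hS hx with ⟨h', -⟩ | ⟨-, h'⟩
      · exact absurd rfl h'
      · exact h'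
    · rintro ⟨he₀, hp⟩
      exact mem_cluster_of_edge (cluster_isolate_subset ω v hp) he₀ (ends_swap hm.ends₀)

section Side

variable [Fintype E] [DecidableEq E] {h : V} (hxh : x ≠ h)
include hxh

/-- **The side of the L-mark** in terms of the isolated graph: every edge `x–l` red, `h ∉ H′_l`,
with `e₀` red `p ∉ C′_R(h)`, with `e₀` blue `p ∉ C′_B(l)`. -/
theorem IsLMarkAt.mem_tgt_iff {ζ : Config E} :
    ζ ∈ tgtU ends l h {S : Set V | x ∈ S} ↔
      (∀ d, ends d = s(x, l) → ζ d = true) ∧ h ∉ hull (isolate ends x) ζ l ∧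
        (ζ e₀ = true → p ∉ cluster (isolate ends x) ζ h) ∧
        (ζ e₀ = false → p ∉ cluster (isolate ends x) (blue ζ) l) := by
  rw [LocRows.mem_tgt_iff]
  have hlx : l ≠ x := hm.xl.symm
  constructor
  · rintro ⟨hh, hxR, hxB⟩
    have hhR : h ∉ cluster ends ζ l := fun h' => hh (Or.inl h')
    have hhB : h ∉ cluster ends (blue ζ) l := fun h' => hh (Or.inr h')
    -- every edge `x–l` is red
    have hd : ∀ d, ends d = s(x, l) → ζ d = true := by
      intro d hd'
      cases hζd : ζ d with
      | true => rfl
      | false =>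
        exfalso
        have hb : blue ζ d = true := by rw [blue_eq_true_iff]; exact hζd
        exact hxB (mem_cluster_of_edge (mem_cluster_self _ _ _) hb (ends_swap hd'))
    have hdb : ∀ d, ends d = s(x, l) → blue ζ d = false := by
      intro d hd'
      rw [blue_apply, hd d hd']; rfl
    have hR := hm.cluster_eq_of_allRed hd
    have hB := hm.cluster_transport_leaf hdb hlx
    refine ⟨hd, ?_, ?_, ?_⟩
    · rintro (h1 | h1)
      · exact hhR (by rw [hR]; exact Or.inl (Or.inl h1))
      · exact hhB ((hB.1 h hxh.symm).2 h1)
    · intro he₀ hp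
      apply hhR
      rw [hR]
      exact Or.inr ⟨he₀, conn_symm hp⟩
    · intro he₀ hp
      apply hxB
      exact hB.2.2 ⟨by rw [blue_eq_true_iff]; exact he₀, hp⟩
  · rintro ⟨hd, hh', hpR, hpB⟩
    have hdb : ∀ d, ends d = s(x, l) → blue ζ d = false := by
      intro d hd'
      rw [blue_apply, hd d hd']; rfl
    have hR := hm.cluster_eq_of_allRed hd
    have hB := hm.cluster_transport_leaf hdb hlx
    have hhR : h ∉ cluster ends ζ l := by
      rw [hR]
      rintro ((h1 | h1) | ⟨he₀, h1⟩)
      · exact hh' (Or.inl h1)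
      · exact hxh.symm h1
      · exact hpR he₀ (conn_symm h1)
    have hhB : h ∉ cluster ends (blue ζ) l := fun h1 => hh' (Or.inr ((hB.1 h hxh.symm).1 h1))
    refine ⟨fun h1 => h1.elim hhR hhB, ?_, ?_⟩
    · rw [hR]; exact Or.inl (Or.inr rfl)
    · intro hx
      obtain ⟨he₀, hp⟩ := hB.2.1 hx
      rw [blue_eq_true_iff] at he₀
      exact hpB he₀ hp

omit hm in
/-- **On the side of the L-mark the red edge set of `h` is that of the isolated graph** (as for the
H-mark: `x ∈ C_R(l)` keeps it out of `C_R(h)`). -/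
theorem IsLMarkAt.redEdges_eq {ζ : Config E} (hζ : ζ ∈ tgtU ends l h {S : Set V | x ∈ S}) :
    redEdges ends ζ h = redEdges (isolate ends x) ζ h := by
  have hC : cluster ends ζ h = cluster (isolate ends x) ζ h :=
    cluster_eq_isolate_of_notMem (x_notMem_cluster_h hζ)
  ext e
  simp only [mem_redEdges]
  rw [hC, within_isolate_eq (x_notMem_cluster_isolate hxh.symm)]

end Side

end LocRows

end Summit.Ventures.PercRepro2
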